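import Summits.Ventures.CertifiedArithmetic.LowPrec.SRTwoSumExactSmall
import Summits.Ventures.CertifiedArithmetic.LowPrec.SRLimitedBitsOptimal
import HarnessLib

/-!
# The 2Sum-under-SR exactness law: surely exact iff `maxScaled ≤ 4^p` (file XLIV)

HONEST FRAMING: certified error envelopes and provably optimal rounding/accumulation schemes for
low-precision formats under stated cost models; every table by two implementations; no hardware or
vendor claims.

**`twoSumE_exact_iff`: for every minifloat format, 2Sum executed under saturating stochastic
rounding satisfies `P(s + t = a + b) = 1` for ALL data iff `maxScaled ≤ 4^(m+1)`** (the largest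
finite magnitude is at most `4^p` quanta).  "If" is file XLIII b.  "Only if" is an explicit pair:
whenever some value exceeds `4^p` quanta, the next value above `4^p` quanta is `4^p + 2^(p+1)`
quanta (`pow_dvd_of_representable`), and for `a = quantum`, `b = 4^p · quantum`

  `P(s + t = a + b) = 1 − 2^-(m+2)` exactly (`twoSumE_witness`):

`a + b = (4^p + 1)` quanta rounds down to `b` (then everything is exact) or, with probability
`2^-(p+1)`, up to `s = (4^p + 2^(p+1))` quanta; on that branch `a' = s − b = 2^(p+1)` quanta
exactly, `b' = b`, `δ_b = 0`, and `δ_a = SR(a − a') = SR(−(2^(p+1) − 1)` quanta`)` is NEVER the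
exact (odd, too wide) value, so `t = δ_a ≠ a + b − s` surely.  Dichotomy of formats
(`maxScaled_dichotomy`): `maxScaled ≤ 4^p` or `4^p + 2^(p+1) ≤ maxScaled`.

Named formats (`decide` on `maxScaled`): surely exact — E2M1 (`12 ≤ 16`), E2M3 (`60 ≤ 256`);
NOT surely exact — E3M2 (`448`; the witness is `(1/16, 4)` with `P = 15/16`), E4M3, E5M2 (and
every format with at least three exponent bits and IEEE-like range).  Compare: 2Sum under SR is
exactly UNBIASED in every format (file XXXVIII), and Fast2Sum under SR obeys the all-or-nothing
law of file XXXVI.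

[cite: BoldoGraillatMuller2017, Thm 4.1 (faithful 2Sum is not an EFT in general); the format law:
new]
-/

namespace Summit.Ventures.CertifiedArithmetic.LowPrec.SR

open Literature.ComputerArithmetic.ConnollyHighamMary2021
open Literature.ComputerArithmetic.FloatingPoint
open Finset MiniFloat

section Formats

variable {φ : Format}

/-- `0 ∈ F` (also in file `SRRungR3Exact`, not imported here). -/
private theorem zero_mem (φ : Format) : (0 : ℚ) ∈ valueSet φ := by
  have h := toRat_mem_valueSet (MiniFloat.zero φ); rwa [toRat_zero] at h

/-- One SR step, unfolded (for rewriting the OUTERMOST step only). -/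
theorem step_apply (F : Finset ℚ) (c : ℚ) (f : ℚ → ℚ) :
    step F c f = pUp F c * f (up F c) + (1 - pUp F c) * f (dn F c) := rfl

/-- A representable natural multiple of the quantum is a value. -/
theorem natMul_mem_of_representable {n : ℕ} (h : φ.Representable n) :
    (n : ℚ) * φ.quantum ∈ valueSet φ := by
  have h' := intMul_mem_valueSet (φ := φ) (N := (n : ℤ)) (by simpa using h)
  simpa using h'

/-- THE NEXT VALUE ABOVE `4^p` QUANTA: a representable magnitude exceeding `4^(m+1)` is at least
`4^(m+1) + 2^(m+2)` (values `≥ 2^(2m+2)` quanta are multiples of `2^(m+2)` quanta). -/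
theorem le_of_representable_gt {n : ℕ} (hn : φ.Representable n) (hgt : 4 ^ (φ.manBits + 1) < n) :
    4 ^ (φ.manBits + 1) + 2 ^ (φ.manBits + 2) ≤ n := by
  have h4 : 4 ^ (φ.manBits + 1) = 2 ^ (φ.manBits + (φ.manBits + 2)) := by
    rw [show (4 : ℕ) = 2 ^ 2 by norm_num, ← pow_mul]; congr 1; ring
  have hd : 2 ^ (φ.manBits + 2) ∣ n :=
    Format.pow_dvd_of_representable hn (by rw [← h4]; exact hgt.le)
  have hd4 : 2 ^ (φ.manBits + 2) ∣ 4 ^ (φ.manBits + 1) :=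
    ⟨2 ^ φ.manBits, by rw [h4, ← pow_add]; congr 1; ring⟩
  obtain ⟨k, hk⟩ := hd
  obtain ⟨j, hj⟩ := hd4
  rw [hk, hj] at hgt ⊢
  have hjk : j + 1 ≤ k := Nat.lt_of_mul_lt_mul_left hgt
  calc 2 ^ (φ.manBits + 2) * j + 2 ^ (φ.manBits + 2) = 2 ^ (φ.manBits + 2) * (j + 1) := by ring
    _ ≤ 2 ^ (φ.manBits + 2) * k := Nat.mul_le_mul_left _ hjk

/-- **DICHOTOMY OF FORMATS**: either every value is at most `4^p` quanta, or some value is at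
least `4^p + 2^(p+1)` quanta. -/
theorem maxScaled_dichotomy (φ : Format) :
    φ.maxScaled ≤ 4 ^ (φ.manBits + 1) ∨
      4 ^ (φ.manBits + 1) + 2 ^ (φ.manBits + 2) ≤ φ.maxScaled := by
  rcases le_or_gt φ.maxScaled (4 ^ (φ.manBits + 1)) with h | h
  · exact Or.inl h
  · exact Or.inr (le_of_representable_gt (representable_maxScaled φ) h)

/-- The odd magnitude `2^(m+2) − 1` quanta (too wide for the significand) is not a value. -/
theorem neg_pred_pow_notMem (φ : Format) :
    -(((2 ^ (φ.manBits + 2) : ℕ) : ℚ) - 1) * φ.quantum ∉ valueSet φ := by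
  intro h
  obtain ⟨v, hv⟩ := mem_valueSet.mp h
  have hI : v.toInt = -((2 ^ (φ.manBits + 2) : ℕ) - 1 : ℤ) :=
    toInt_eq_of_toRat_eq (by rw [hv]; push_cast; ring)
  have hodd : Odd v.toInt := by
    rw [hI, odd_neg]
    refine ⟨(2 ^ (φ.manBits + 1) : ℕ) - 1, ?_⟩
    push_cast; rw [pow_succ]; ring
  have hlt := natAbs_lt_pow_of_odd v hodd
  rw [hI, Int.natAbs_neg] at hlt
  have h1 : (1 : ℤ) ≤ (2 ^ (φ.manBits + 2) : ℕ) := by exact_mod_cast Nat.one_le_two_pow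
  have h2 : ((2 ^ (φ.manBits + 2) : ℕ) - 1 : ℤ).natAbs = 2 ^ (φ.manBits + 2) - 1 := by omega
  rw [h2, pow_succ] at hlt
  have h3 := Nat.one_le_two_pow (n := φ.manBits + 1)
  omega

/-- **THE WITNESS.** If some value is at least `4^p + 2^(p+1)` quanta then for `a = quantum`,
`b = 4^p · quantum`: `P(s + t = a + b) = 1 − 2^-(m+2)`. -/
theorem twoSumE_witness (hbig : 4 ^ (φ.manBits + 1) + 2 ^ (φ.manBits + 2) ≤ φ.maxScaled) :
    ∃ a b : MiniFloat φ, a.toRat = φ.quantum ∧ b.toRat = 4 ^ (φ.manBits + 1) * φ.quantum ∧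
      twoSumE (valueSet φ) a.toRat b.toRat
        (fun s t => if s + t = a.toRat + b.toRat then 1 else 0) = 1 - 1 / 2 ^ (φ.manBits + 2) := by
  have hq := φ.quantum_pos
  have hF := valueSet_nonempty φ
  -- exponent bookkeeping: `P = 2^(p+1)`, `Q = 4^p` as atoms
  obtain ⟨P, hP⟩ : ∃ P : ℕ, P = 2 ^ (φ.manBits + 2) := ⟨_, rfl⟩
  obtain ⟨Q, hQ⟩ : ∃ Q : ℕ, Q = 4 ^ (φ.manBits + 1) := ⟨_, rfl⟩
  have hQP : Q = P * 2 ^ φ.manBits := by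
    rw [hP, hQ, show (4 : ℕ) = 2 ^ 2 by norm_num, ← pow_mul, ← pow_add]; congr 1; ring
  have h8 : 2 ^ (φ.manBits + 1 + (φ.manBits + 2)) = 2 * Q := by
    rw [hQ, show (4 : ℕ) = 2 ^ 2 by norm_num, ← pow_mul, ← pow_succ']; congr 1; ring
  have h2P : 2 ≤ P := by
    rw [hP, pow_succ]; have := Nat.one_le_two_pow (n := φ.manBits + 1); omega
  have hPQ : P ≤ Q := by rw [hQP]; exact Nat.le_mul_of_pos_right _ (Nat.one_le_two_pow)
  rw [← hP, ← hQ] at hbig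
  have hQq : (4 : ℚ) ^ (φ.manBits + 1) = Q := by rw [hQ]; push_cast; ring
  have hPq : (2 : ℚ) ^ (φ.manBits + 2) = P := by rw [hP]; push_cast; ring
  rw [hQq, hPq]
  -- the five values `Q, Q + P, P, 1, P − 2` quanta, and the non-value `P − 1` quanta
  have hdP : 2 ^ (φ.manBits + 2) ∣ P := by rw [hP]
  have hdQ : 2 ^ (φ.manBits + 2) ∣ Q := ⟨2 ^ φ.manBits, by rw [hQP, hP]⟩
  have vQ : (Q : ℚ) * φ.quantum ∈ valueSet φ :=
    natMul_mem_of_representable (representable_of_pow_dvd hdQ (by omega) (by omega))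
  have vU : ((Q + P : ℕ) : ℚ) * φ.quantum ∈ valueSet φ :=
    natMul_mem_of_representable (representable_of_pow_dvd (dvd_add hdQ hdP) (by omega) hbig)
  have vP : (P : ℚ) * φ.quantum ∈ valueSet φ :=
    natMul_mem_of_representable (representable_of_pow_dvd hdP (by omega) (by omega))
  have v1 : φ.quantum ∈ valueSet φ := by
    have h := intMul_mem_of_natAbs_le_pow (φ := φ) (N := 1) (by simp [Nat.one_le_two_pow])
      (by simp; omega)
    simpa using h
  have vE : ((P : ℚ) - 2) * φ.quantum ∈ valueSet φ := by
    have h := intMul_mem_of_even (φ := φ) (N := (P : ℤ) - 2)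
      ⟨(2 ^ (φ.manBits + 1) : ℕ) - 1, by rw [hP]; push_cast; rw [pow_succ]; ring⟩
      (by rw [← hP]; omega) (by omega)
    push_cast at h; exact h
  have nE : -((P : ℚ) - 1) * φ.quantum ∉ valueSet φ := by
    have h := neg_pred_pow_notMem φ; rwa [← hP] at h
  -- the data
  obtain ⟨a, ha⟩ := mem_valueSet.mp v1
  obtain ⟨b, hb⟩ := mem_valueSet.mp vQ
  refine ⟨a, b, ha, hb, ?_⟩
  rw [twoSumE_eq, ha, hb]
  -- the gap `(Q, Q + P)` quanta around `a + b = (Q + 1)` quanta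
  have hgap : ∀ y ∈ valueSet φ, y ≤ (Q : ℚ) * φ.quantum ∨ ((Q + P : ℕ) : ℚ) * φ.quantum ≤ y := by
    intro y hy
    obtain ⟨v, rfl⟩ := mem_valueSet.mp hy
    rcases le_or_gt v.toRat ((Q : ℚ) * φ.quantum) with h | h
    · exact Or.inl h
    · right
      have hv0 : 0 ≤ v.toRat := le_trans (by positivity) h.le
      rw [toRat_eq_toInt_mul, toInt_eq_scaledMag_of_nonneg hv0] at h ⊢
      push_cast at h ⊢
      have h' : (Q : ℚ) < v.scaledMag := lt_of_mul_lt_mul_right h hq.le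
      have hle := le_of_representable_gt (representable_scaledMag v)
        (by rw [← hQ]; exact_mod_cast h')
      rw [← hP, ← hQ] at hle
      exact mul_le_mul_of_nonneg_right (by exact_mod_cast hle) hq.le
  obtain ⟨-, hdn, hup, hp⟩ := LimitedBits.candidates_of_gap vQ vU hgap
    (x := φ.quantum + (Q : ℚ) * φ.quantum) (by linarith)
    (by push_cast; have : (2 : ℚ) ≤ P := by exact_mod_cast h2P
        nlinarith)
  rw [step_apply (valueSet φ) (φ.quantum + (Q : ℚ) * φ.quantum), hdn, hup, hp]
  -- branch `s = b` (round down): everything exact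
  have hdnval : step (valueSet φ) ((Q : ℚ) * φ.quantum - (Q : ℚ) * φ.quantum)
      (fun a' => step (valueSet φ) (φ.quantum - a')
        (fun da => step (valueSet φ) ((Q : ℚ) * φ.quantum - ((Q : ℚ) * φ.quantum - a'))
          (fun db => step (valueSet φ) (da + db) fun t =>
            if (Q : ℚ) * φ.quantum + t = φ.quantum + (Q : ℚ) * φ.quantum
            then (1 : ℚ) else 0))) = 1 := by
    rw [sub_self, step_of_mem (zero_mem φ)]; simp only [sub_zero]
    rw [step_of_mem v1, sub_self, step_of_mem (zero_mem φ), add_zero, step_of_mem v1,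
      if_pos (by ring)]
  -- branch `s = (Q + P)` quanta (round up): `a' = P` quanta, `δ_b = 0`, `t = δ_a` never exact
  have hupval : step (valueSet φ) (((Q + P : ℕ) : ℚ) * φ.quantum - (Q : ℚ) * φ.quantum)
      (fun a' => step (valueSet φ) (φ.quantum - a')
        (fun da => step (valueSet φ) ((Q : ℚ) * φ.quantum - (((Q + P : ℕ) : ℚ) * φ.quantum - a'))
          (fun db => step (valueSet φ) (da + db) fun t =>
            if ((Q + P : ℕ) : ℚ) * φ.quantum + t = φ.quantum + (Q : ℚ) * φ.quantum
            then (1 : ℚ) else 0))) = 0 := by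
    rw [show ((Q + P : ℕ) : ℚ) * φ.quantum - (Q : ℚ) * φ.quantum = (P : ℚ) * φ.quantum by
      push_cast; ring, step_of_mem vP]
    refine step_eq_of_faithful hF _ fun da hda => ?_
    rw [show (Q : ℚ) * φ.quantum - (((Q + P : ℕ) : ℚ) * φ.quantum - (P : ℚ) * φ.quantum) = 0 by
      push_cast; ring, step_of_mem (zero_mem φ), add_zero, step_of_mem hda.mem, if_neg]
    intro heq
    have hda' : da = -((P : ℚ) - 1) * φ.quantum := by push_cast at heq; linarith
    exact nE (hda' ▸ hda.mem)
  rw [hdnval, hupval, mul_zero, zero_add, mul_one,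
    show φ.quantum + (Q : ℚ) * φ.quantum - (Q : ℚ) * φ.quantum = φ.quantum by ring,
    show ((Q + P : ℕ) : ℚ) * φ.quantum - (Q : ℚ) * φ.quantum = (P : ℚ) * φ.quantum by
      push_cast; ring,
    div_mul_cancel_right₀ hq.ne', one_div]

/-- **THE 2SUM-UNDER-SR EXACTNESS LAW.** 2Sum under saturating SR returns `s + t = a + b` with
probability one for ALL data iff the largest finite magnitude is at most `4^(m+1)` quanta. -/
theorem twoSumE_exact_iff (φ : Format) :
    (∀ a b : MiniFloat φ, twoSumE (valueSet φ) a.toRat b.toRat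
        (fun s t => if s + t = a.toRat + b.toRat then 1 else 0) = 1) ↔
      φ.maxScaled ≤ 4 ^ (φ.manBits + 1) := by
  refine ⟨fun h => ?_, fun hM a b => twoSumE_exact_of_small hM a b⟩
  rcases maxScaled_dichotomy φ with hM | hbig
  · exact hM
  · exfalso
    obtain ⟨a, b, -, -, hab⟩ := twoSumE_witness hbig
    have h1 := h a b
    rw [hab] at h1
    have h2 : (0 : ℚ) < 1 / 2 ^ (φ.manBits + 2) := by positivity
    linarith

/-- In a format with a value beyond `4^p` quanta, 2Sum under SR is NOT surely exact. -/
theorem twoSumE_not_sure_of_big (hbig : 4 ^ (φ.manBits + 1) < φ.maxScaled) :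
    ¬ ∀ a b : MiniFloat φ, twoSumE (valueSet φ) a.toRat b.toRat
        (fun s t => if s + t = a.toRat + b.toRat then 1 else 0) = 1 :=
  fun h => absurd ((twoSumE_exact_iff φ).mp h) (not_le.mpr hbig)

/-! ### Named formats -/

/-- **E3M2 (OCP FP6): NOT surely exact** — `maxScaled = 448 > 64`; the structural witness is
`a = 1/16`, `b = 4` with `P(s + t = a + b) = 15/16` (the minimum over all pairs is `81/256`,
`twoSum_not_sure_E3M2`, file XXXVIII). -/
theorem twoSumE_witness_E3M2 :
    ∃ a b : MiniFloat Format.E3M2, a.toRat = 1 / 16 ∧ b.toRat = 4 ∧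
      twoSumE (valueSet Format.E3M2) a.toRat b.toRat
        (fun s t => if s + t = a.toRat + b.toRat then 1 else 0) = 15 / 16 := by
  obtain ⟨a, b, ha, hb, h⟩ := twoSumE_witness (φ := Format.E3M2) (by decide)
  refine ⟨a, b, ?_, ?_, ?_⟩
  · rw [ha]; decide +kernel
  · rw [hb]; decide +kernel
  · rw [h]; decide +kernel

/-- E4M3 and E5M2 (OCP FP8): NOT surely exact (`maxScaled` far beyond `4^p`). -/
theorem twoSumE_not_sure_FP8 :
    (¬ ∀ a b : MiniFloat Format.E4M3, twoSumE (valueSet Format.E4M3) a.toRat b.toRat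
        (fun s t => if s + t = a.toRat + b.toRat then 1 else 0) = 1) ∧
    (¬ ∀ a b : MiniFloat Format.E5M2, twoSumE (valueSet Format.E5M2) a.toRat b.toRat
        (fun s t => if s + t = a.toRat + b.toRat then 1 else 0) = 1) :=
  ⟨twoSumE_not_sure_of_big (by decide), twoSumE_not_sure_of_big (by decide)⟩

/-- **AMONG THE FIVE OCP MICRO-FORMATS, 2Sum under SR is an error-free transformation exactly on
E2M1 and E2M3.** -/
theorem twoSumE_exact_named :
    (Format.E2M1.maxScaled ≤ 4 ^ (Format.E2M1.manBits + 1)) ∧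
    (Format.E2M3.maxScaled ≤ 4 ^ (Format.E2M3.manBits + 1)) ∧
    ¬ (Format.E3M2.maxScaled ≤ 4 ^ (Format.E3M2.manBits + 1)) ∧
    ¬ (Format.E4M3.maxScaled ≤ 4 ^ (Format.E4M3.manBits + 1)) ∧
    ¬ (Format.E5M2.maxScaled ≤ 4 ^ (Format.E5M2.manBits + 1)) := by
  refine ⟨by decide, by decide, by decide, by decide, by decide⟩

end Formats

end Summit.Ventures.CertifiedArithmetic.LowPrec.SR
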